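import Summits.QuantumFields.BalabanUV.Beta.RemainderExplicitHistoryDiagonalRateBorderline

/-!
# RemainderExplicitHistoryDiagonalRateThreshold — ROAD P3, ORDER-0 PROFILE FAMILY: THE RATE IN THE CUTOFF BELOW THE THRESHOLD — along two
# infrared-pinned runs the matched discrepancy is NEARLY NON-INCREASING TOWARDS THE PIN, `d_{j+1} ≤ (1 + Wγ³∕2)·d_j` (the window damping of the
# first file is at most `W·e_j ≤ (Wγ³∕2)·d_j` per step), so the third file's rate at the threshold distance `σ₀` (`A₂ ≤ b√b·√σ₀`) descends to
# EVERY infrared distance `m ≤ σ₀` at the cost of the constant `(1 + Wγ³∕2)^{σ₀−m}`: `astar g m − invSq g m n ≤ (1+Wγ³∕2)^{σ₀−m}·Λ√σ₀·τ(n+m+1−σ₀)`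
# (`2σ₀ ≤ n+m+1`); borderline profile: `≤ (1+Wγ³∕2)^{σ₀−m}·Λ√σ₀·3M∕√(n+m+2−σ₀)` (sixth file of station S-d4p3-g49-1 «the rate in the cutoff»)

Cell `pub-balaban`, β-function sub-cell, BINDER row D4 «RemainderConst leaves for Bałaban's split» (`HOME/BINDER-OWNERS.md`; owner
lineage `b2b-balaban-beta-an4`; this file by co-owner #3 lineage `b2b-balaban-beta-d4-p3`, road P3 «the reduction road», generation 49,
station S-d4p3-g49-1, sixth file; imports the station's fifth file `RemainderExplicitHistoryDiagonalRateBorderline`), β-FLOW TEAM duty (1);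
FREEZE (0) honoured (def-free module in road P3's own `RemainderExplicit*` series; no leaf, no interface, no Literature file).  SOURCE OF THE
SHAPES ONLY: [Balaban1987RG1] (0.20) p. 256, (0.31) and Thm 2 p. 259, §5 p. 298.  Pure real analysis about ONE explicit toy family (ours).

HONEST FRAMING (page 1 of everything the β sub-cell writes).  *"Discharging BetaPertH makes Bałaban's UV stability UNCONDITIONAL — a real
constructive-QFT result; it is NOT the continuum limit and NOT the Clay problem."*  THIS FILE DISCHARGES NOTHING OF THE KIND.  The third
file's majorant induction needs the infrared distance `σ` to exceed a threshold (`A₂ ≤ b√b·√σ`: the feedback's share `ΛA₂∕(2b√b)` must fit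
under half the majorant `Λ√σ`), void only for small profiles.  This file removes the threshold at the price of a constant: by the first file's
step identity `d_j − d_{j+1} = E_j + Σ_{i≤j} ρ(j−i)(e_i − e_j)`, with `E_j ≥ 0`, `e_i ≥ 0` and `Σ_{i≤j} ρ(j−i) ≤ W`, one has
`d_{j+1} ≤ d_j + W·e_j ≤ (1 + Wγ³∕2)·d_j` (`e_j ≤ (g^A_j)³∕2·d_j`, `g^A_j ≤ γ`) — the discrepancy can grow towards the pin by at most the
factor `1 + Wγ³∕2` per step (numerically it never grows: `g49/rate_numerics3.out`, all profiles tested; the sign of the window damping at a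
single step is not claimed).  Hence the rate at the threshold distance `σ₀` of the same pair transfers to every `m ≤ σ₀` (§2), and the
borderline instance of the fifth file holds for every `1 ≤ m ≤ σ₀` (§3).  Nothing of Bałaban's (1.22) is asserted or constructed; row D4 class
UNCHANGED (critical-path width 0; instance 0∕1; D4 DISCHARGE NO DATE); NOT B12 Thm 2, NOT BetaPertH, NOT continuum, NOT Clay.  HONEST
DEPENDENCY: continuum YM on T⁴ ⇐ BetaPertH ∧ nine spine estimates (0/9 proved); BetaPertH ⇐ (D1) ∧ (D4) ∧ CAP+tail; G-an2-4 gates asym,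
D1 and NE2/3/4.  ABSOLUTE RULE: nothing is cited as a fact.

WHAT IS PROVED ([folklore]; 0 sorry; 0 `def`).
* §1 **`disc_succ_le`** (`d_{j+1} ≤ (1 + Wγ³∕2)·d_j`, `j < K`), `disc_add_le_pow_mul` (`d_{j+t} ≤ (1 + Wγ³∕2)^t·d_j`, `j + t ≤ K`).
* §2 **`astar_sub_invSq_le_rate_threshold`** (family form: `m ≤ σ₀`, `A₂ ≤ b√b√σ₀`, `2σ₀ ≤ n+m+1` ⇒
  `astar g m − invSq g m n ≤ (1+Wγ³∕2)^{σ₀−m}·Λ√σ₀·τ(n+m+1−σ₀)`).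
* §3 **`borderline_rate_threshold`** (`ρ(a) = M∕((a+1)√(a+1))`: `18√2M ≤ b√b√σ₀`, `m ≤ σ₀`, `2σ₀ ≤ n+m+1` ⇒
  `astar g m − invSq g m n ≤ (1+Wγ³∕2)^{σ₀−m}·Λ√σ₀·3M∕√(n+m+2−σ₀)`).
All letters NOT-IN-PRINT; `BetaFlowAsPrinted S` records a Markov β_n only ⇒ no junction of the as-printed interface changes.
-/

noncomputable section

open Finset Filter Topology

namespace Summit.QuantumFields.BalabanUV.Beta.RemainderExplicitHistoryDiagonalRateThreshold

open Literature.MathematicalPhysics.QuantumFieldTheory.Balaban1983to89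
open Literature.MathematicalPhysics.QuantumFieldTheory.Balaban1983to89.FlowStep
open Literature.MathematicalPhysics.QuantumFieldTheory.Balaban1983to89.T4CouplingMatching
open Literature.MathematicalPhysics.QuantumFieldTheory.Balaban1983to89.T4ContinuumCoupling
open Summit.QuantumFields.BalabanUV.Beta.RemainderExplicitHistoryDiagonalMonotone
open Summit.QuantumFields.BalabanUV.Beta.RemainderExplicitHistoryDiagonalWeights
open Summit.QuantumFields.BalabanUV.Beta.RemainderExplicitHistoryDiagonalTwoRun
open Summit.QuantumFields.BalabanUV.Beta.RemainderExplicitHistoryDiagonalWindow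
open Summit.QuantumFields.BalabanUV.Beta.RemainderExplicitHistoryDiagonalRate
open Summit.QuantumFields.BalabanUV.Beta.RemainderExplicitHistoryDiagonalRateBorderline

variable {β : HBeta} {b γ W A₁ A₂ : ℝ} {ρ τ : ℕ → ℝ}

/-! ## §1 The matched discrepancy is nearly non-increasing towards the pin -/

/-- **ONE STEP TOWARDS THE PIN COSTS AT MOST THE FACTOR `1 + Wγ³∕2`.**  Two runs of the order-0 profile family in ]0,γ] (`b > 0`, `ρ ≥ 0`,
`Σ_{a<N} ρ_a ≤ W`) — A: `K` steps, B: `K + n` steps — pinned; for `j < K`: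
`1∕(g^B_{j+1+n})² − 1∕(g^A_{j+1})² ≤ (1 + Wγ³∕2)·(1∕(g^B_{j+n})² − 1∕(g^A_j)²)` (`…Window.disc_step_window`: `d_j − d_{j+1} = E_j + Σ_{i≤j}
ρ(j−i)(e_i − e_j) ≥ −W·e_j`, and `e_j ≤ (g^A_j)³∕2·d_j ≤ (γ³∕2)·d_j`). [cite: Balaban1987RG1, (0.20) p.256 and Thm 2 p.259] -/
theorem disc_succ_le
    (hβ : ∀ (k : ℕ) (p : Fin (k + 1) → ℝ),
      β k p = b + ∑ i : Fin (k + 1), ρ (k - i) * min (p (Fin.last k)) (|p (Fin.last k) - p i|))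
    (hb : 0 < b) (hρ0 : ∀ a, 0 ≤ ρ a) (hρW : ∀ n, ∑ a ∈ range n, ρ a ≤ W) {K n : ℕ} {gA gB : ℕ → ℝ}
    (hA : RGEqH K β gA) (hB : RGEqH (K + n) β gB) (hAbox : ∀ k, k ≤ K → 0 < gA k ∧ gA k ≤ γ)
    (hBpos : ∀ k, k ≤ K + n → 0 < gB k) (hpin : gA K = gB (K + n)) {j : ℕ} (hj : j < K) :
    1 / (gB (j + 1 + n)) ^ 2 - 1 / (gA (j + 1)) ^ 2
      ≤ (1 + W * γ ^ 3 / 2) * (1 / (gB (j + n)) ^ 2 - 1 / (gA j) ^ 2) := by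
  have hApos : ∀ k, k ≤ K → 0 < gA k := fun k hk => (hAbox k hk).1
  have hW : 0 ≤ W := by simpa using hρW 0
  have hstep := disc_step_window hβ hb hρ0 hA hB hApos hBpos hj
  have hdom := invSq_le_invSq_shift_run hβ hb hρ0 hA hB hApos hBpos hpin
  have he : ∀ i, i ≤ K → 0 ≤ gA i - gB (i + n) := fun i hi => by
    linarith [le_of_one_div_sq_le (hApos i hi) (hBpos (i + n) (by omega)) (hdom i hi)]
  have hd0 : 0 ≤ 1 / (gB (j + n)) ^ 2 - 1 / (gA j) ^ 2 := by have := hdom j hj.le; linarith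
  -- the extra-age source is nonnegative
  have hE : 0 ≤ ∑ i ∈ range n, ρ (j + n - i) * (gB (j + n) - gB i) := by
    refine Finset.sum_nonneg fun i hi => mul_nonneg (hρ0 _) ?_
    have hi' : i < n := Finset.mem_range.mp hi
    linarith [run_mono_orderZero hβ hb hρ0 hB hBpos (show i ≤ j + n by omega) (by omega)]
  -- the common ages' term is at least `−W·e_j`
  have hF : -(W * (gA j - gB (j + n)))
      ≤ ∑ i ∈ range (j + 1), ρ (j - i) * ((gA i - gB (i + n)) - (gA j - gB (j + n))) := by
    have hR : ∑ i ∈ range (j + 1), ρ (j - i) ≤ W := by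
      have h' : ∑ i ∈ range (j + 1), ρ (j - i) = ∑ i ∈ range (j + 1), ρ i := by
        rw [← Finset.sum_range_reflect ρ (j + 1)]
        refine Finset.sum_congr rfl fun i hi => ?_
        have hi' := Finset.mem_range.mp hi
        rw [show j + 1 - 1 - i = j - i by omega]
      rw [h']; exact hρW (j + 1)
    calc -(W * (gA j - gB (j + n))) ≤ -((∑ i ∈ range (j + 1), ρ (j - i)) * (gA j - gB (j + n))) := by
          have := he j hj.le; nlinarith
      _ = ∑ i ∈ range (j + 1), ρ (j - i) * (-(gA j - gB (j + n))) := by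
          rw [Finset.sum_mul, ← Finset.sum_neg_distrib]; exact Finset.sum_congr rfl fun i _ => by ring
      _ ≤ ∑ i ∈ range (j + 1), ρ (j - i) * ((gA i - gB (i + n)) - (gA j - gB (j + n))) := by
          refine Finset.sum_le_sum fun i hi => mul_le_mul_of_nonneg_left ?_ (hρ0 _)
          have hi' : i ≤ j := Nat.lt_succ_iff.mp (Finset.mem_range.mp hi)
          linarith [he i (hi'.trans hj.le)]
  -- `e_j ≤ (γ³∕2)·d_j`
  have hej : gA j - gB (j + n) ≤ γ ^ 3 / 2 * (1 / (gB (j + n)) ^ 2 - 1 / (gA j) ^ 2) := by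
    have h1 := gap_le_cube_mul (hBpos (j + n) (by omega))
      (le_of_one_div_sq_le (hApos j hj.le) (hBpos (j + n) (by omega)) (hdom j hj.le))
    have hγj := (hAbox j hj.le)
    have h2 : (gA j) ^ 3 / 2 ≤ γ ^ 3 / 2 := by
      have := pow_le_pow_left₀ hγj.1.le hγj.2 3
      linarith
    exact h1.trans (mul_le_mul_of_nonneg_right h2 hd0)
  nlinarith [mul_nonneg hW (he j hj.le)]

/-- Iterated: `d_{j+t} ≤ (1 + Wγ³∕2)^t·d_j` for `j + t ≤ K`. [cite: Balaban1987RG1, (0.20) p.256 and Thm 2 p.259] -/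
theorem disc_add_le_pow_mul
    (hβ : ∀ (k : ℕ) (p : Fin (k + 1) → ℝ),
      β k p = b + ∑ i : Fin (k + 1), ρ (k - i) * min (p (Fin.last k)) (|p (Fin.last k) - p i|))
    (hb : 0 < b) (hρ0 : ∀ a, 0 ≤ ρ a) (hρW : ∀ n, ∑ a ∈ range n, ρ a ≤ W) {K n : ℕ} {gA gB : ℕ → ℝ}
    (hA : RGEqH K β gA) (hB : RGEqH (K + n) β gB) (hAbox : ∀ k, k ≤ K → 0 < gA k ∧ gA k ≤ γ)
    (hBbox : ∀ k, k ≤ K + n → 0 < gB k ∧ gB k ≤ γ) (hpin : gA K = gB (K + n)) {j : ℕ} :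
    ∀ t, j + t ≤ K → 1 / (gB (j + t + n)) ^ 2 - 1 / (gA (j + t)) ^ 2
      ≤ (1 + W * γ ^ 3 / 2) ^ t * (1 / (gB (j + n)) ^ 2 - 1 / (gA j) ^ 2) := by
  have hBpos : ∀ k, k ≤ K + n → 0 < gB k := fun k hk => (hBbox k hk).1
  have hW : 0 ≤ W := by simpa using hρW 0
  have hγ : 0 ≤ γ := by have := hAbox K le_rfl; linarith
  have hq : 0 ≤ 1 + W * γ ^ 3 / 2 := by positivity
  intro t
  induction t with
  | zero => intro _; simp
  | succ t ih =>
    intro ht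
    have h1 := ih (by omega)
    have h2 := disc_succ_le hβ hb hρ0 hρW hA hB hAbox hBpos hpin (j := j + t) (by omega)
    rw [show j + (t + 1) = j + t + 1 by omega, pow_succ]
    calc 1 / (gB (j + t + 1 + n)) ^ 2 - 1 / (gA (j + t + 1)) ^ 2
        ≤ (1 + W * γ ^ 3 / 2) * (1 / (gB (j + t + n)) ^ 2 - 1 / (gA (j + t)) ^ 2) := h2
      _ ≤ (1 + W * γ ^ 3 / 2) * ((1 + W * γ ^ 3 / 2) ^ t * (1 / (gB (j + n)) ^ 2 - 1 / (gA j) ^ 2)) :=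
          mul_le_mul_of_nonneg_left h1 hq
      _ = (1 + W * γ ^ 3 / 2) ^ t * (1 + W * γ ^ 3 / 2) * (1 / (gB (j + n)) ^ 2 - 1 / (gA j) ^ 2) := by ring

/-! ## §2 The rate below the threshold distance -/

/-- **ROAD P3 — THE RATE IN THE CUTOFF AT EVERY INFRARED DISTANCE BELOW THE THRESHOLD.**  A family `K ↦ g K` of runs of the order-0
profile family in ]0,γ] pinned at one `g_IR`, with the hypotheses of the third file's `astar_sub_invSq_le_rate` (tail majorant `τ` of polynomial
type, `Wγ < b`), and a threshold distance `σ₀` with `A₂ ≤ b√b·√σ₀`.  THEN for every `m ≤ σ₀` and every cutoff `n` with `2σ₀ ≤ n + m + 1`: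
`0 ≤ astar g m − invSq g m n ≤ (1 + Wγ³∕2)^{σ₀−m}·Λ·√σ₀·τ(n+m+1−σ₀)`, `Λ = 4∕√b + 8√2κA₁∕((1−Wγ∕b)√b)` — the third file's bound at the
position of infrared distance `σ₀` of the same pair, carried to the pin side by `disc_add_le_pow_mul`.
[cite: Balaban1987RG1, (0.20) p.256, (0.31) and Thm 2 p.259] -/
theorem astar_sub_invSq_le_rate_threshold
    (hβ : ∀ (k : ℕ) (p : Fin (k + 1) → ℝ),
      β k p = b + ∑ i : Fin (k + 1), ρ (k - i) * min (p (Fin.last k)) (|p (Fin.last k) - p i|))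
    (hb : 0 < b) (hγ : 0 < γ) (hρ0 : ∀ a, 0 ≤ ρ a) (hρW : ∀ n, ∑ a ∈ range n, ρ a ≤ W) (hsmall : W * γ < b)
    (hτ0 : ∀ k, 0 ≤ τ k) (hτmono : ∀ k l, k ≤ l → τ l ≤ τ k)
    (hτ : ∀ k N, k ≤ N → ∑ a ∈ range N, ρ a - ∑ a ∈ range k, ρ a ≤ τ k) (hA₁ : 0 ≤ A₁)
    (hUV : ∀ K N : ℕ, 1 ≤ K → ∑ a ∈ range N, ρ a * (min (a : ℝ) K) ^ 2 ≤ A₁ * (K : ℝ) ^ 2 * τ K)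
    (hT2 : ∀ j₀ : ℕ, ∑ i ∈ range j₀, τ (i + 1) * τ (j₀ - i) / ((j₀ + 1 - i : ℕ) : ℝ) ≤ A₂ * τ (j₀ + 1))
    {g : ℕ → ℕ → ℝ} {gIR : ℝ} (hrun : ∀ K, RGEqH K β (g K)) (hbox : ∀ K i, i ≤ K → 0 < g K i ∧ g K i ≤ γ)
    (hpin : ∀ K, g K K = gIR) {σ₀ m n : ℕ} (hσ₀ : A₂ ≤ b * Real.sqrt b * Real.sqrt (σ₀ : ℝ)) (hm : m ≤ σ₀)
    (hn : 2 * σ₀ ≤ n + m + 1) :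
    0 ≤ astar g m - invSq g m n ∧ astar g m - invSq g m n
      ≤ (1 + W * γ ^ 3 / 2) ^ (σ₀ - m)
        * ((4 / Real.sqrt b + 8 * Real.sqrt 2 * ((b + W * γ) / b) * A₁ / ((1 - W * γ / b) * Real.sqrt b))
          * Real.sqrt (σ₀ : ℝ) * τ (n + m + 1 - σ₀)) := by
  have ht : Tendsto (invSq g m) atTop (𝓝 (astar g m)) := (continuum_monotone hβ hb hγ hρ0 hρW hrun hbox hpin).1 m
  have hmono := invSq_mono hβ hb hρ0 hrun hbox hpin m
  have h1 : invSq g m n ≤ astar g m := hmono.ge_of_tendsto ht n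
  set C : ℝ := (1 + W * γ ^ 3 / 2) ^ (σ₀ - m)
        * ((4 / Real.sqrt b + 8 * Real.sqrt 2 * ((b + W * γ) / b) * A₁ / ((1 - W * γ / b) * Real.sqrt b))
          * Real.sqrt (σ₀ : ℝ) * τ (n + m + 1 - σ₀)) with hC
  -- the bound between the cutoffs `n` and `n + n'`
  have hpair : ∀ n', invSq g m (n + n') - invSq g m n ≤ C := by
    intro n'
    have hpin' : g (n + m) (n + m) = g (n + m + n') (n + m + n') := by rw [hpin, hpin]
    -- the third file's bound at the position `j₁ = n + m − σ₀`
    have hmaj := disc_le_majorant hβ hb hγ hρ0 hρW hsmall hτ0 hτmono hτ hA₁ hUV hT2 (hrun (n + m)) (hrun (n + m + n'))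
      (hbox (n + m)) (hbox (n + m + n')) hpin' (n + m - σ₀) (by omega) (by omega)
      (by rw [show n + m - (n + m - σ₀) = σ₀ by omega]; exact hσ₀)
    rw [show n + m - (n + m - σ₀) = σ₀ by omega, show n + m - σ₀ + 1 = n + m + 1 - σ₀ by omega] at hmaj
    -- carried `σ₀ − m` steps towards the pin
    have hcarry := disc_add_le_pow_mul hβ hb hρ0 hρW (hrun (n + m)) (hrun (n + m + n')) (hbox (n + m)) (hbox (n + m + n'))
      hpin' (j := n + m - σ₀) (σ₀ - m) (by omega)
    rw [show n + m - σ₀ + (σ₀ - m) = n by omega] at hcarry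
    have hq : 0 ≤ (1 + W * γ ^ 3 / 2) ^ (σ₀ - m) := by
      have hW : 0 ≤ W := by simpa using hρW 0
      positivity
    have e1 : invSq g m (n + n') = 1 / (g (n + m + n') (n + n')) ^ 2 := by
      rw [invSq_def, show n + n' + m = n + m + n' by omega]
    rw [e1, invSq_def]
    exact hcarry.trans (mul_le_mul_of_nonneg_left hmaj hq)
  have hev : ∀ᶠ k in atTop, invSq g m k ≤ invSq g m n + C := by
    refine Filter.eventually_atTop.mpr ⟨n, fun k hk => ?_⟩
    obtain ⟨n', rfl⟩ := Nat.exists_eq_add_of_le hk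
    linarith [hpair n']
  have h2 : astar g m ≤ invSq g m n + C := le_of_tendsto ht hev
  constructor <;> linarith

/-! ## §3 The borderline profile below the threshold -/

/-- **THE BORDERLINE RATE AT EVERY INFRARED DISTANCE BELOW THE THRESHOLD.**  A pinned family of runs of the order-0 profile family with the
borderline profile `ρ(a) = M∕((a+1)√(a+1))` (`M > 0`, `Σ_{a<N} ρ_a ≤ W`, `Wγ < b`), a threshold distance `σ₀` with `18√2·M ≤ b√b·√σ₀`; THEN for
every `m ≤ σ₀` and `n` with `2σ₀ ≤ n + m + 1`:
`astar g m − invSq g m n ≤ (1 + Wγ³∕2)^{σ₀−m}·Λ·√σ₀·3M∕√(n+m+2−σ₀)`, `Λ = 4∕√b + 24√2κ∕((1−Wγ∕b)√b)` — still the rate `1∕√n` in the cutoff.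
[cite: Balaban1987RG1, (0.20) p.256, (0.31) and Thm 2 p.259] -/
theorem borderline_rate_threshold {M : ℝ}
    (hβ : ∀ (k : ℕ) (p : Fin (k + 1) → ℝ),
      β k p = b + ∑ i : Fin (k + 1), ρ (k - i) * min (p (Fin.last k)) (|p (Fin.last k) - p i|))
    (hb : 0 < b) (hγ : 0 < γ) (hM : 0 < M) (hρ : ∀ a, ρ a = M / (((a : ℝ) + 1) * Real.sqrt ((a : ℝ) + 1)))
    (hρW : ∀ n, ∑ a ∈ range n, ρ a ≤ W) (hsmall : W * γ < b)
    {g : ℕ → ℕ → ℝ} {gIR : ℝ} (hrun : ∀ K, RGEqH K β (g K)) (hbox : ∀ K i, i ≤ K → 0 < g K i ∧ g K i ≤ γ)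
    (hpin : ∀ K, g K K = gIR) {σ₀ m n : ℕ} (hσ₀ : 18 * Real.sqrt 2 * M ≤ b * Real.sqrt b * Real.sqrt (σ₀ : ℝ)) (hm : m ≤ σ₀)
    (hn : 2 * σ₀ ≤ n + m + 1) :
    0 ≤ astar g m - invSq g m n ∧ astar g m - invSq g m n
      ≤ (1 + W * γ ^ 3 / 2) ^ (σ₀ - m)
        * ((4 / Real.sqrt b + 8 * Real.sqrt 2 * ((b + W * γ) / b) * 3 / ((1 - W * γ / b) * Real.sqrt b))
          * Real.sqrt (σ₀ : ℝ) * (3 * M / Real.sqrt (((n + m + 1 - σ₀ : ℕ) : ℝ) + 1))) := by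
  have hρ0 : ∀ a, 0 ≤ ρ a := fun a => by rw [hρ a]; positivity
  have hτ0 : ∀ k : ℕ, 0 ≤ 3 * M / Real.sqrt ((k : ℝ) + 1) := fun k => by positivity
  have hτmono : ∀ k l : ℕ, k ≤ l → 3 * M / Real.sqrt ((l : ℝ) + 1) ≤ 3 * M / Real.sqrt ((k : ℝ) + 1) := by
    intro k l hkl
    exact div_le_div_of_nonneg_left (by positivity) (Real.sqrt_pos.2 (by positivity))
      (Real.sqrt_le_sqrt (by exact_mod_cast Nat.add_le_add_right hkl 1))
  exact astar_sub_invSq_le_rate_threshold (τ := fun k => 3 * M / Real.sqrt ((k : ℝ) + 1)) (A₁ := 3) (A₂ := 18 * Real.sqrt 2 * M)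
    hβ hb hγ hρ0 hρW hsmall hτ0 hτmono (fun k N hkN => borderline_tail_le hM.le hρ hkN) (by norm_num)
    (fun K N hK => borderline_T1 hM.le hρ K N hK) (fun j₀ => borderline_T2 M j₀) hrun hbox hpin hσ₀ hm hn

end Summit.QuantumFields.BalabanUV.Beta.RemainderExplicitHistoryDiagonalRateThreshold

end
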